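import Literature.NumberTheory.Transcendental.PhilipponZeroEstimateIdeals
import Literature.NumberTheory.Transcendental.PhilipponZeroEstimateMultiplicity
import Literature.NumberTheory.Transcendental.PhilipponZeroEstimateLoc
import HarnessLib

/-!
# Philippon's zero estimate on `𝔾ₐ × 𝔾ₘ^n`: Prop. 3.8, Step 1

Topic `Literature/NumberTheory/Transcendental`. Tenth module of the inline discharge of
`Literature.NumberTheory.Transcendental.Philippon1986_GaGm`: Step 1 of D. Roy's proof of the
multiplicity estimate Prop. 3.8 (Nesterenko–Philippon (eds.), LNM 1752, Ch. 11, p. 216), in the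
affine ring `B = ℂ[X, Y₁, …, Y_n]`. If every word of length `≤ T` in the invariant derivations
`D_u`, `u ∈ W`, maps the ideal `𝔄` into the prime `𝔭` (equivalently `∂^T(𝔄) ⊆ 𝔭`,
`wordDeriv_mem_of_dIdeal_le`), then the same holds for the component
`𝔮 = loc 𝔭 𝔄 = 𝔄·B_𝔭 ∩ B` of `𝔄` at `𝔭` (`…Loc.lean`): for `f ∈ 𝔮` with `P f ∈ 𝔄`, `P ∉ 𝔭`, the
product rule and induction on the length give `P · D_u f ∈ 𝔭`, hence `D_u f ∈ 𝔭`. PROVED: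

* `iterate_invDeriv_mem_wordsLE`, `opPow_mem_wordsLE` — the monomials `D^μ` of
  `…Multiplicity.lean` are words of length `|μ|`;
* **`wordDeriv_mem_of_mem_loc`** (Step 1) and its `D^μ`-form `opPow_mem_of_mem_loc`, the
  hypothesis `H𝔮` of `…Independence.lean`;
* `wordDeriv_mem_of_dIdeal_le` — the hypothesis from `∂^T_{e}(𝔄) ≤ 𝔭`.

## References

* Yu. V. Nesterenko, P. Philippon (eds.), *Introduction to Algebraic Independence Theory*,
  LNM 1752, Springer 2001, Ch. 11 (D. Roy), Prop. 3.8, Step 1 (p. 216).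
* P. Philippon, *Lemmes de zéros dans les groupes algébriques commutatifs*, Bull. Soc. Math.
  France 114 (1986), 355–383, §4.
-/

noncomputable section

open MvPolynomial

namespace Literature.NumberTheory.Transcendental

namespace GaGm

variable {n : ℕ} {W : Submodule ℂ (ℂ × (Fin n → ℂ))}

/-! ### `D^μ` is a word -/

/-- Iterating one letter keeps inside `wordsLE`. [folklore] -/
theorem iterate_invDeriv_mem_wordsLE {N : ℕ} {g Q : MvPolynomial (Fin (n + 1)) ℂ} (hQ : Q ∈ wordsLE W N g)
    {a : ℂ × (Fin n → ℂ)} (ha : a ∈ W) (k : ℕ) : (invDeriv a)^[k] Q ∈ wordsLE W (k + N) g := by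
  induction k with
  | zero => simpa using hQ
  | succ k ih =>
    rw [Function.iterate_succ_apply', show k + 1 + N = (k + N) + 1 by ring]
    exact invDeriv_mem_wordsLE ih ha

/-- **`D^μ f` is a word of length `|μ|` in the letters `wᵢ ∈ W` applied to `f`.** [folklore] -/
theorem opPow_mem_wordsLE {s : ℕ} {w : Fin s → ℂ × (Fin n → ℂ)} (hw : ∀ i, w i ∈ W) (μ : Fin s → ℕ)
    (f : MvPolynomial (Fin (n + 1)) ℂ) : opPow w μ f ∈ wordsLE W (order μ) f := by
  induction s with
  | zero =>
    rw [opPow_zero]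
    simpa [order] using self_mem_wordsLE W 0 f
  | succ s ih =>
    rw [opPow_succ]
    have h := iterate_invDeriv_mem_wordsLE (ih (fun i => hw i.succ) (Fin.tail μ)) (hw 0) (μ 0)
    have hord : order μ = μ 0 + order (Fin.tail μ) := by
      simp only [order, Fin.sum_univ_succ]; rfl
    rwa [hord]

/-! ### Step 1 -/

/-- **Prop. 3.8, Step 1.** Let `𝔭` be prime and suppose every word of length `≤ T` (letters in
`W`) sends `𝔄` into `𝔭`. Then every such word sends the component `loc 𝔭 𝔄` into `𝔭`.
[cite: NesterenkoPhilippon2001, Ch. 11 Prop. 3.8 (Step 1)] -/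
theorem wordDeriv_mem_of_mem_loc {𝔭 𝔄 : Ideal (MvPolynomial (Fin (n + 1)) ℂ)} (h𝔭 : 𝔭.IsPrime) {T : ℕ}
    (h𝔄 : ∀ f ∈ 𝔄, ∀ k ≤ T, ∀ v : Fin k → ℂ × (Fin n → ℂ), (∀ i, v i ∈ W) → wordDeriv v f ∈ 𝔭)
    {f : MvPolynomial (Fin (n + 1)) ℂ} (hf : f ∈ loc 𝔭 h𝔭 𝔄) :
    ∀ k ≤ T, ∀ v : Fin k → ℂ × (Fin n → ℂ), (∀ i, v i ∈ W) → wordDeriv v f ∈ 𝔭 := by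
  obtain ⟨P, hP, hPf⟩ := hf
  intro k
  induction k using Nat.strong_induction_on with
  | _ k ih =>
    intro hk v hv
    have h1 : wordDeriv v (P * f) ∈ 𝔭 := h𝔄 _ hPf k hk v hv
    cases k with
    | zero =>
      have hv0 : v = Fin.elim0 := funext fun i => i.elim0
      subst hv0
      rw [wordDeriv_zero] at h1 ⊢
      exact (h𝔭.mem_or_mem h1).resolve_left hP
    | succ k =>
      have h2 := wordDeriv_mul_sub_mem_span v hv P f
      have h3 : Ideal.span (wordsLE W k f) ≤ 𝔭 := by
        rw [Ideal.span_le]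
        rintro _ ⟨j, hj, u, hu, rfl⟩
        exact ih j (by omega) (by omega) u hu
      have h4 : P * wordDeriv v f ∈ 𝔭 := by
        have := 𝔭.sub_mem h1 (h3 h2)
        rwa [sub_sub_cancel] at this
      exact (h𝔭.mem_or_mem h4).resolve_left hP

/-- **Step 1 in `D^μ`-form** (the hypothesis `H𝔮` of `…Independence.lean`): with `wᵢ ∈ W`,
`|μ| ≤ T` and `f ∈ loc 𝔭 𝔄`, `D^μ f ∈ 𝔭`. [cite: NesterenkoPhilippon2001, Ch. 11 Prop. 3.8 (Step 1)] -/
theorem opPow_mem_of_mem_loc {𝔭 𝔄 : Ideal (MvPolynomial (Fin (n + 1)) ℂ)} (h𝔭 : 𝔭.IsPrime) {T : ℕ}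
    (h𝔄 : ∀ f ∈ 𝔄, ∀ k ≤ T, ∀ v : Fin k → ℂ × (Fin n → ℂ), (∀ i, v i ∈ W) → wordDeriv v f ∈ 𝔭)
    {s : ℕ} {w : Fin s → ℂ × (Fin n → ℂ)} (hw : ∀ i, w i ∈ W) :
    ∀ f ∈ loc 𝔭 h𝔭 𝔄, ∀ μ : Fin s → ℕ, order μ ≤ T → opPow w μ f ∈ 𝔭 := by
  intro f hf μ hμ
  obtain ⟨j, hj, u, hu, hju⟩ := opPow_mem_wordsLE hw μ f
  rw [hju]
  exact wordDeriv_mem_of_mem_loc h𝔭 h𝔄 hf j (hj.trans hμ) u hu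

/-- The hypothesis of Step 1 from `∂^T_{e}(𝔄) ≤ 𝔭`. [folklore] -/
theorem wordDeriv_mem_of_dIdeal_le {𝔭 𝔄 : Ideal (MvPolynomial (Fin (n + 1)) ℂ)} {T : ℕ}
    (h : dIdeal W {(1 : GaGm n)} T 𝔄 ≤ 𝔭) :
    ∀ f ∈ 𝔄, ∀ k ≤ T, ∀ v : Fin k → ℂ × (Fin n → ℂ), (∀ i, v i ∈ W) → wordDeriv v f ∈ 𝔭 := by
  intro f hf k hk v hv
  refine h (le_sat _ (Ideal.subset_span ⟨1, rfl, wordDeriv v f, ⟨f, hf, k, hk, v, hv, rfl⟩, ?_⟩))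
  rw [shift_one]
  rfl

end GaGm

end Literature.NumberTheory.Transcendental
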